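import Summits.ABC.IUTFork.Cor312Steps
import Summits.ABC.IUTFork.Cor312Statement
import Summits.ABC.IUTFork.Thm311LogKummer
import HarnessLib

/-!
# [IUTchIII] Corollary 3.12, proof nodes: opening ¶ and Steps (i)–(v), over the real definitions
# (TEAM A, row A-5 slice 1)

Record-only file (D-0012) of the abc-iut cell (Cor. 3.12 strategy TEAM A «direct III§3», seat
abc-iut-c312-10 = A2; row **A-5 slice 1** of `HOME/plan/C312-TEAMS.md`, claimed 23:17:22Z after rows
A-0…A-4 were all delivered or in flight); TAKES NO SIDE. Companion to `Cor312StepXReal.lean` (A-1),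
`Cor312StepXIabcReal.lean` (A-2), c312-4's `Cor312StepXIdeReal.lean` (A-3) and A1's `Cor312ReadingIso` /
GAP-witness files (A-4): it discharges the proof nodes **opening paragraph (wlog)** and **Steps
(i)–(v)** of [IUTchIII] Cor. 3.12 (kurims text `paper:url-4b091feeb646`, p. 174 l. 20 – p. 177 l. 34;
`Cor312Proof.Step.wlog/i/ii/iii/iv/v`) as kernel inferences over the frozen definitions, in the modular
pointwise style of A-1/A-2 (per the A-5 row note: several of these early observations are recalls of
the cited loci — their readings are honest PASS-THROUGHS of the loci contents, "say so in the
docstrings, do not inflate"; the two with kernel content over the frozen setting are proved outright).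

Readings (quotes from this seat's renders):

* `Obs.restrictToStrips` (opening ¶, p. 175 l. 11–13: "we may restrict our attention to possible
  images of a Θ-pilot object that correspond to data … that may be interpreted as an
  `𝓕^⊩▶`-prime-strip"). Pass-through parameter `CRestrict`, wired in `stepWlog_holds` from the cited
  loci `def3_8_i` (pilot objects) and `rem3_9_5_i` (hulls) — the restriction is part of the cited
  construction, not derivable from the frozen `Setting` (whose `possibleImages` already carries it as
  the glue `thetaRegionOf`'s provenance).
* `Obs.linkSplits` / `Obs.valueGroupMapsPilots` ((i), p. 175 l. 32–49: the link "may be thought of as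
  consisting of a "unit portion" … and a "value group portion" …"; "This value group portion … maps
  Θ-pilot objects … to `q`-pilot objects"). Pass-through parameters `CSplit`, `CVG` wired from the
  cited loci `def3_8_ii` (the link), `def2_4_iii`, `rem3_8_1`; the intended instantiation of `CVG` is
  c312-1's object-level `PilotLink` (`Thm311ToCor312.lean`, p411317 lane) and of `CSplit` the
  unit/value-group fields of c312-1's `LinkData` (Thm311LinkCompat; L6-t2 Def. 4.9 (vi)–(viii)).
* `Obs.unitsSubjectInd12` ((ii), p. 175 l. 50–52: "the units … are subject to `Aut_{𝓕^⊢×μ}(−)`-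
  indeterminacies [i.e., "(Ind1), (Ind2)"]"). Reading `StepEarly.UnitsInd12`, PROVED OUTRIGHT
  (`unitsInd12_holds`): the (Ind1)- and (Ind2)-families lie inside the indeterminacy group
  `Cor312.Setting.indGroup S` whose orbit defines the possible images — in the frozen model the units
  are subject to EXACTLY these indeterminacies (generators of the acting group).
* `Obs.cyclotomesInsulated` ((ii), p. 175 l. 53–57: "the cyclotomes … which give rise to the "value
  group portion" …, are **insulated** from these … indeterminacies"). Pass-through parameter `CIns`
  wired from the cited cyclotomic-rigidity loci `etTh`, `chI_ex5_1_v`, `chI_def5_2` (the printed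
  sentence's own sources); the frozen-setting shadow — the q-side quantities do not move under a
  glue-twist by the indeterminacy group — is C1's C-1 (`Cor312MultiradTwist.lean`, p411045 lane:
  `twistGlue_negLogQ` etc.), consumed there, never re-proved here.
* `Obs.singleLinkNecessary` ((iii), p. 176 l. 24–33: "the non-commutativity of the log-theta-lattice
  renders it practically impossible … This is precisely why we concentrate on a single
  Θ^{×μ}_{LGP}-link"). Pass-through parameter `CNonComm` wired from the cited locus `rem3_11_3`; the
  in-tree model-level witness of the non-commutativity is skel's `ForkHexagon.hexagon_not_commute`
  (methodological sentence; no inflation).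
* `Obs.verticalShiftSolved` ((iv), p. 176 l. 40 – p. 177 l. 8: "working, on the 0-column, with
  structures that are **invariant with respect to vertical shifts** … only at the cost of admitting the
  "indeterminacy" constituted by the **upper semi-compatibility of (Ind3)**"). Reading
  `StepEarly.ShiftInvariantAtInd3` := c312-1's `Column.MutualCompat ∧ Column.Ind3` (the transported
  data are `m`-independent; the cost is exactly the (Ind3) containments). KERNEL LEMMA
  `shiftInvariantAtInd3_of_kummer`: `MutualCompat` from the Thm 3.11 (ii) (b), (c) contents (landed
  `Column.mutualCompat_of_kummerB_kummerC`), wired in `stepIV_holds` from the loci `thm3_11_ii_b`,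
  `thm3_11_ii_c`, `Ind3` — all three cited by (iv) on the page.
* `Obs.unitsRelatedContainers` ((v), p. 177 l. 9–23: units related "by means of the unit portion … and
  then applying the **bi-coricity** of the units"; log-shells as ""multiradial mono-analytic
  containers""). Pass-through parameter `CBiCoric` wired from the cited bi-coricity loci `thm1_5_iii`,
  `thm1_5_iv` (c312-1's `LinkData.ofBiCoric` p408087 is the typed source); the "containers" are the
  frozen fields `MRData.shellPk`/`logvol` of `S.D P.n` — data, nothing to prove.
* `Obs.frobeniusLikeRelatedToCoric` ((v), p. 177 l. 26–34: "we will relate the … local units …,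
  splitting monoids …, global Frobenioids indexed by `(0,m)` … to the vertically coric … containers **by
  means of the log-Kummer correspondences of Theorem 3.11, (ii), (a), (b), (c)**"). Reading
  `StepEarly.FrobToCoric` := `Column.KummerA ∧ KummerB ∧ KummerC` for the setting's data — precisely
  the cited correspondences; wired in `stepV_holds` from the loci `thm3_11_ii_a/b/c`, all three cited
  by (v) on the page.

`Cor312Proof.stepWlog_holds` / `stepI_holds` / `stepII_holds` / `stepIII_holds` / `stepIV_holds` /
`stepV_holds` prove the six `Step.Holds` under any reading wired to these contents. With A-1 (x), A-2
((xi-a)–(xi-c), p411416 lane), A-3 ((xi-d)–(xi-e), c312-4 p411129) and A-4 ((xi-f)–(xii), A1), the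
remaining per-step rows of the twenty-node chain are Steps (vi)–(ix) (A-5 slice 2, offered to skel
23:17:22Z) and the (xi-g)/(xi-h)/(xii) cheap tail (A-4).

Sources read on the page (this seat's renders): pp. 174–177. [claim: Mochizuki2012, status: disputed]
Deliberately NOT here: Steps (vi)–(ix) (slice 2); the loci contents themselves (c312-2 locus
resolution / dag; TEAM B real instances); the (xi-f) edge (A-4); any judgement.
-/

noncomputable section

open Set

namespace Summit.ABC

namespace IUTFork

namespace StepEarly

open Thm311

variable {T : ThetaIndex} {S : Situation T} (P : Cor312.Setting S)

/-! ## 1. The two kernel readings of Step (ii)/(iv)/(v) territory -/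

/-- READING of `Obs.unitsSubjectInd12` ((ii), p. 175 l. 50–52): in the frozen model the units are
subject to EXACTLY the (Ind1), (Ind2) indeterminacies — the two families lie inside the group
`Cor312.Setting.indGroup S = ⟨Ind1Family ∪ Ind2Family⟩` whose orbit of the (Ind3)-union defines the
possible images of the Θ-pilot object. [claim: Mochizuki2012, status: disputed] -/
@[claim "Mochizuki2012" "disputed"] def UnitsInd12 (S : Situation T) : Prop :=
  S.L.Ind1Family ⊆ (Cor312.Setting.indGroup S : Set S.L.PacketAut) ∧
    S.L.Ind2Family ⊆ (Cor312.Setting.indGroup S : Set S.L.PacketAut)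

/-- `UnitsInd12` holds outright (`Subgroup.subset_closure` on each generator family). [folklore] -/
theorem unitsInd12_holds (S : Situation T) : UnitsInd12 S :=
  ⟨fun _Φ hΦ => Subgroup.subset_closure (Set.mem_union_left _ hΦ),
    fun _Φ hΦ => Subgroup.subset_closure (Set.mem_union_right _ hΦ)⟩

/-- READING of `Obs.verticalShiftSolved` ((iv), p. 176 l. 40 – p. 177 l. 8): the transported data of
the column are invariant under the vertical shift (`Column.MutualCompat`), at the cost of the (Ind3)
upper semi-compatibility containments (`Column.Ind3` — upper bounds only, no equality).
[claim: Mochizuki2012, status: disputed] -/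
@[claim "Mochizuki2012" "disputed"] def ShiftInvariantAtInd3 (C : Column S.L) : Prop :=
  C.MutualCompat ∧ C.Ind3 (S.D P.n)

/-- **KERNEL LEMMA**: the shift-invariance clause from the Thm 3.11 (ii) (b), (c) contents (the landed
`Column.mutualCompat_of_kummerB_kummerC`: all transported data read the one vertically coric datum);
the (Ind3) clause is the cited locus's own content. [folklore] -/
theorem shiftInvariantAtInd3_of_kummer (C : Column S.L) (hB : C.KummerB (S.D P.n))
    (hKC : C.KummerC (S.D P.n)) (hI3 : C.Ind3 (S.D P.n)) : ShiftInvariantAtInd3 P C :=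
  ⟨C.mutualCompat_of_kummerB_kummerC (S.D P.n) hB hKC, hI3⟩

/-- READING of `Obs.frobeniusLikeRelatedToCoric` ((v), p. 177 l. 26–34): the Frobenius-like data at the
`(0, m)` are related to the vertically coric containers by the log-Kummer correspondences of Thm 3.11
(ii) (a), (b), (c) — c312-1's `Column.KummerA/KummerB/KummerC` for the setting's data.
[claim: Mochizuki2012, status: disputed] -/
@[claim "Mochizuki2012" "disputed"] def FrobToCoric (C : Column S.L) : Prop :=
  C.KummerA (S.D P.n) ∧ C.KummerB (S.D P.n) ∧ C.KummerC (S.D P.n)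

end StepEarly

/-! ## 2. The six nodes as inferences -/

namespace Cor312Proof

open StepEarly Thm311

variable {T : ThetaIndex} {S : Situation T} (P : Cor312.Setting S)

/-- **Opening paragraph HOLDS** under any reading wired to the restriction content `CRestrict`
(pass-through of the cited loci `def3_8_i`, `rem3_9_5_i`; module docstring).
[claim: Mochizuki2012, status: disputed] -/
theorem stepWlog_holds {L : Locus → Prop} {O : Obs → Prop} {CRestrict : Prop}
    (hR : L .def3_8_i → L .rem3_9_5_i → CRestrict)
    (hO : CRestrict → O .restrictToStrips) : Step.wlog.Holds L O := by
  intro hc _hu o ho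
  have ho' : o = Obs.restrictToStrips := by simpa [Step.concl, Step.data] using ho
  subst ho'
  exact hO (hR (hc _ (by decide)) (hc _ (by decide)))

/-- **Step (i) HOLDS** under any reading wired to the split and value-group contents (pass-throughs of
the cited loci; intended instantiations: c312-1 `LinkData` portions and `PilotLink`).
[claim: Mochizuki2012, status: disputed] -/
theorem stepI_holds {L : Locus → Prop} {O : Obs → Prop} {CSplit CVG : Prop}
    (hS : L .def3_8_ii → L .def2_4_iii → CSplit)
    (hV : L .def3_8_ii → L .rem3_8_1 → CVG)
    (hO1 : CSplit → O .linkSplits) (hO2 : CVG → O .valueGroupMapsPilots) :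
    Step.i.Holds L O := by
  intro hc _hu o ho
  have ho' : o = Obs.linkSplits ∨ o = Obs.valueGroupMapsPilots := by
    simpa [Step.concl, Step.data] using ho
  rcases ho' with rfl | rfl
  · exact hO1 (hS (hc _ (by decide)) (hc _ (by decide)))
  · exact hO2 (hV (hc _ (by decide)) (hc _ (by decide)))

/-- **Step (ii) HOLDS**: `unitsSubjectInd12` on its kernel reading outright (`unitsInd12_holds`);
`cyclotomesInsulated` from the cited cyclotomic-rigidity loci (pass-through `CIns`; frozen-setting
shadow = C1's glue-twist invariance, module docstring). [claim: Mochizuki2012, status: disputed] -/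
theorem stepII_holds {L : Locus → Prop} {O : Obs → Prop} {CIns : Prop}
    (hI : L .etTh → L .chI_ex5_1_v → L .chI_def5_2 → CIns)
    (hO1 : UnitsInd12 S → O .unitsSubjectInd12)
    (hO2 : CIns → O .cyclotomesInsulated) : Step.ii.Holds L O := by
  intro hc _hu o ho
  have ho' : o = Obs.unitsSubjectInd12 ∨ o = Obs.cyclotomesInsulated := by
    simpa [Step.concl, Step.data] using ho
  rcases ho' with rfl | rfl
  · exact hO1 (unitsInd12_holds S)
  · exact hO2 (hI (hc _ (by decide)) (hc _ (by decide)) (hc _ (by decide)))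

/-- **Step (iii) HOLDS** under any reading wired to the non-commutativity content `CNonComm`
(pass-through of the cited locus `rem3_11_3`; model witness skel `ForkHexagon.hexagon_not_commute`).
[claim: Mochizuki2012, status: disputed] -/
theorem stepIII_holds {L : Locus → Prop} {O : Obs → Prop} {CNonComm : Prop}
    (hN : L .rem3_11_3 → CNonComm)
    (hO : CNonComm → O .singleLinkNecessary) : Step.iii.Holds L O := by
  intro hc _hu o ho
  have ho' : o = Obs.singleLinkNecessary := by simpa [Step.concl, Step.data] using ho
  subst ho'
  exact hO (hN (hc _ (by decide)))

/-- **Step (iv) HOLDS**: `verticalShiftSolved` on its reading `ShiftInvariantAtInd3`, derived from the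
cited loci — (ii) (b), (c) contents for the mutual compatibility (landed bookkeeping) and the (Ind3)
locus for the containments. [claim: Mochizuki2012, status: disputed] -/
theorem stepIV_holds (C : Column S.L) {L : Locus → Prop} {O : Obs → Prop}
    (hB : L .thm3_11_ii_b → C.KummerB (S.D P.n))
    (hKC : L .thm3_11_ii_c → C.KummerC (S.D P.n))
    (hI3 : L .Ind3 → C.Ind3 (S.D P.n))
    (hO : ShiftInvariantAtInd3 P C → O .verticalShiftSolved) : Step.iv.Holds L O := by
  intro hc _hu o ho
  have ho' : o = Obs.verticalShiftSolved := by simpa [Step.concl, Step.data] using ho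
  subst ho'
  exact hO (shiftInvariantAtInd3_of_kummer P C (hB (hc _ (by decide))) (hKC (hc _ (by decide)))
    (hI3 (hc _ (by decide))))

/-- **Step (v) HOLDS**: `unitsRelatedContainers` from the cited bi-coricity loci (pass-through
`CBiCoric`); `frobeniusLikeRelatedToCoric` on its reading `FrobToCoric`, assembled from the loci
`thm3_11_ii_a/b/c` — all cited by (v) on the page. [claim: Mochizuki2012, status: disputed] -/
theorem stepV_holds (C : Column S.L) {L : Locus → Prop} {O : Obs → Prop} {CBiCoric : Prop}
    (hBC : L .thm1_5_iii → L .thm1_5_iv → CBiCoric)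
    (hA : L .thm3_11_ii_a → C.KummerA (S.D P.n))
    (hB : L .thm3_11_ii_b → C.KummerB (S.D P.n))
    (hKC : L .thm3_11_ii_c → C.KummerC (S.D P.n))
    (hO1 : CBiCoric → O .unitsRelatedContainers)
    (hO2 : FrobToCoric P C → O .frobeniusLikeRelatedToCoric) : Step.v.Holds L O := by
  intro hc _hu o ho
  have ho' : o = Obs.unitsRelatedContainers ∨ o = Obs.frobeniusLikeRelatedToCoric := by
    simpa [Step.concl, Step.data] using ho
  rcases ho' with rfl | rfl
  · exact hO1 (hBC (hc _ (by decide)) (hc _ (by decide)))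
  · exact hO2 ⟨hA (hc _ (by decide)), hB (hc _ (by decide)), hKC (hc _ (by decide))⟩

end Cor312Proof

end IUTFork

end Summit.ABC

end
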